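import Literature.NumberTheory.GaloisRepresentations.TateLevelOneLocalCharacters
import Literature.NumberTheory.GaloisRepresentations.TateH2VanishingCyclic
import Literature.NumberTheory.GaloisRepresentations.LocalGlobalCohomologyProofs
import Literature.NumberTheory.GaloisRepresentations.DecompositionGroupOfCompletion
import Literature.NumberTheory.Automorphic.AdicCompletionLocalField
import HarnessLib

/-!
# Tate's theorem `H²(G_ℚ, ℚ/ℤ) = 0` at level one, IV: finiteness of the support of a class of
# `H²(K, ℤ/p)` (cochain form)

Sibling proof file (theorems only) of `TateProjectiveLifting.lean` (Serre, Durham 1977, §6.5 run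
over `ℚ`; see `TateLevelOneLocalCharacters.lean`).  Serre §6.5 (c) (i): for `α ∈ Br_p(K)`,
"`α_v = 0` for almost all `v`".  In the cochain language of the tree and for the trivial module
`ℤ/p ⊂ ℚ/ℤ` this is: a locally constant `p`-torsion `2`-cocycle `g` on `Γ_K` restricts, at all but
finitely many finite places `v`, to a cocycle on `Γ_{K_v}` which is `∂β` with `β` locally constant
**and `p • β = 0`** (`twoCocycle_nsmul_split_levelOne_eventually`).  Proof: `g` is invariant under
an open normal subgroup `N ⊴ Γ_K` (uniform local constancy on the profinite `Γ_K`); `N` contains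
`Gal(K̄/E)` for a finite Galois `E`, and the inertia groups at almost all `v` fix `E`
(`eventually_forall_inertia_mem_fixingSubgroup`, the tree's "finite extensions are unramified
almost everywhere"); at such `v` the restricted cocycle factors through the finite quotient
`Γ_{K_v} / res⁻¹(N) ⊇ I_{K_v}`, cyclic generated by Frobenius (`Γ_{K_v}/I_{K_v}` is procyclic), on
which `H²(·, ℚ/ℤ) = 0` (`twoCocycle_addCircle_split_of_isCyclic`); the resulting splitting `b` has
`p b` an unramified character, hence a `p`-th multiple (`unramified_character_nsmul_divisible`),
and correcting `b` by it gives a `p`-torsion splitting (`twoCocycle_nsmul_split_levelOne_of_invariant`).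

## References

* J.-P. Serre, *Modular forms of weight one and Galois representations* (Durham 1977), §6.5 (c).
  [SerreDurham1977]
* J. Neukirch, *Algebraic Number Theory* (1999), Ch. II §9 Prop. (9.6), Ch. III §2 Thm. (2.6).
  [NeukirchANT1999]
-/

noncomputable section

open Field ValuativeRel IsDedekindDomain
open scoped Pointwise Valued NumberField

namespace Literature.NumberTheory.GaloisRepresentations

open GaloisRepresentations.IsNonarchimedeanLocalField

universe u

/-! ### Local: cocycles through an unramified finite quotient split at level one -/

section Local

variable (F : Type u) [Field F] [ValuativeRel F] [TopologicalSpace F] [IsNonarchimedeanLocalField F]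

/-- **A cocycle factoring through an unramified finite quotient of `Γ_F` splits at level one.**
Let `g : Γ_F × Γ_F → ℚ/ℤ` be a `2`-cocycle with `p • g = 0` (`p ≥ 1`), invariant in each variable
under an open normal subgroup `U ⊴ Γ_F` containing the inertia group `I_F`.  Then `g = ∂β` with
`β` locally constant and `p • β = 0`.  (`Γ_F / U` is finite cyclic, generated by Frobenius, and
`H²` of a finite cyclic group with values in the divisible group `ℚ/ℤ` vanishes, so `g = ∂b` with
`b` constant on `U`-cosets; `p b` is then an unramified character, `= p b'`, and `β = b - b'`.)
This is the vanishing of `H²(Γ_F/I_F, ℤ/p) → H²(Γ_F, ℤ/p) → H²(Γ_F, ℚ/ℤ)`… at level one: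
"`α_v = 0`" at an unramified place (Serre §6.5 (c) (i)).
[cite: SerreDurham1977, §6.5 (c)] [cite: SerreLocalFields1979, Ch. XIII §4 App.] -/
theorem twoCocycle_nsmul_split_levelOne_of_invariant {p : ℕ} (hp : 0 < p)
    (g : absoluteGaloisGroup F → absoluteGaloisGroup F → AddCircle (1 : ℚ))
    (hcoc : ∀ σ τ υ, g σ τ + g (σ * τ) υ = g τ υ + g σ (τ * υ)) (hpg : ∀ σ τ, p • g σ τ = 0)
    (U : Subgroup (absoluteGaloisGroup F)) [U.Normal] (hU : IsOpen (U : Set (absoluteGaloisGroup F)))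
    (hIU : absInertia F ≤ U) (hgU : ∀ σ τ, ∀ u₁ ∈ U, ∀ u₂ ∈ U, g (σ * u₁) (τ * u₂) = g σ τ) :
    ∃ β : absoluteGaloisGroup F → AddCircle (1 : ℚ), IsLocallyConstant β ∧
      (∀ σ τ, g σ τ + β (σ * τ) = β σ + β τ) ∧ ∀ σ, p • β σ = 0 := by
  classical
  haveI : CompactSpace (absoluteGaloisGroup F) := absoluteGaloisGroup_compactSpace F
  -- the finite quotient `Q = Γ_F / U`
  set π : absoluteGaloisGroup F →* absoluteGaloisGroup F ⧸ U := QuotientGroup.mk' U with hπ_def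
  haveI : Finite (absoluteGaloisGroup F ⧸ U) := Subgroup.quotient_finite_of_isOpen U hU
  -- `Q` is cyclic, generated by Frobenius
  obtain ⟨φ, hφ⟩ := exists_isAbsArithFrob_holds F
  have hker : π.ker = U := QuotientGroup.ker_mk' U
  haveI : IsCyclic (absoluteGaloisGroup F ⧸ U) := by
    refine ⟨⟨π φ, fun x => ?_⟩⟩
    obtain ⟨σ, rfl⟩ := QuotientGroup.mk'_surjective U x
    obtain ⟨n, hn⟩ := exists_zpow_eq_of_absInertia_le_ker F π (by rw [hker]; exact hU)
      (by rw [hker]; exact hIU) hφ σ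
    exact ⟨n, hn.symm⟩
  -- descend `g` to `Q`
  obtain ⟨gQ, hgQ_def⟩ : ∃ gQ : (absoluteGaloisGroup F ⧸ U) → (absoluteGaloisGroup F ⧸ U) →
      AddCircle (1 : ℚ), gQ = fun x y => g (Quotient.out x) (Quotient.out y) := ⟨_, rfl⟩
  have hgQ : ∀ σ τ, gQ (π σ) (π τ) = g σ τ := by
    intro σ τ
    obtain ⟨n₁, hn₁⟩ := QuotientGroup.mk_out_eq_mul U σ
    obtain ⟨n₂, hn₂⟩ := QuotientGroup.mk_out_eq_mul U τ
    rw [hgQ_def]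
    show g (Quotient.out (π σ)) (Quotient.out (π τ)) = g σ τ
    rw [hπ_def, QuotientGroup.mk'_apply, QuotientGroup.mk'_apply, hn₁, hn₂]
    exact hgU σ τ n₁ n₁.2 n₂ n₂.2
  have hgQ_coc : ∀ x y w, gQ x y + gQ (x * y) w = gQ y w + gQ x (y * w) := by
    intro x y w
    obtain ⟨σ, rfl⟩ := QuotientGroup.mk'_surjective U x
    obtain ⟨τ, rfl⟩ := QuotientGroup.mk'_surjective U y
    obtain ⟨υ, rfl⟩ := QuotientGroup.mk'_surjective U w
    rw [← map_mul, ← map_mul, hgQ, hgQ, hgQ, hgQ]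
    exact hcoc σ τ υ
  -- `H²(Q, ℚ/ℤ) = 0`
  obtain ⟨bQ, hbQ⟩ := twoCocycle_addCircle_split_of_isCyclic gQ hgQ_coc
  set b : absoluteGaloisGroup F → AddCircle (1 : ℚ) := fun σ => bQ (π σ) with hb_def
  have hb : ∀ σ τ, g σ τ + b (σ * τ) = b σ + b τ := fun σ τ => by
    simp only [hb_def, map_mul, ← hgQ]
    exact hbQ _ _
  have hπu : ∀ u ∈ U, π u = 1 := fun u hu => (QuotientGroup.eq_one_iff u).mpr hu
  have hb_lc : IsLocallyConstant b :=
    isLocallyConstant_of_mul_mem b U hU fun σ u hu => by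
      show bQ (π (σ * u)) = bQ (π σ)
      rw [map_mul, hπu u hu, mul_one]
  -- `λ = p • b` is an unramified character
  set lam : absoluteGaloisGroup F → AddCircle (1 : ℚ) := fun σ => p • b σ with hlam_def
  have hlam_lc : IsLocallyConstant lam := hb_lc.comp fun x => p • x
  have hlam : ∀ σ τ, lam (σ * τ) = lam σ + lam τ := fun σ τ => by
    have h := congrArg (fun x => p • x) (hb σ τ)
    simp only [nsmul_add, hpg, zero_add] at h
    exact h
  have hb1 : b 1 = g 1 1 := by
    have h := hb 1 1
    rw [mul_one, add_comm] at h
    exact (add_left_cancel h).symm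
  have hlamI : ∀ σ ∈ absInertia F, lam σ = 0 := fun σ hσ => by
    have h1 : b σ = b 1 := by
      show bQ (π σ) = bQ (π 1)
      rw [hπu σ (hIU hσ), map_one]
    simp only [hlam_def, h1, hb1, hpg]
  obtain ⟨lam', hlam'_lc, hlam'_add, -, hlam'⟩ :=
    unramified_character_nsmul_divisible F lam hlam_lc hlam hlamI hp
  refine ⟨fun σ => b σ - lam' σ, hb_lc.comp₂ hlam'_lc fun x y => x - y, fun σ τ => ?_, fun σ => ?_⟩
  · show g σ τ + (b (σ * τ) - lam' (σ * τ)) = (b σ - lam' σ) + (b τ - lam' τ)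
    rw [hlam'_add, ← add_sub_assoc, hb]
    abel
  · show p • (b σ - lam' σ) = 0
    rw [nsmul_sub, hlam', hlam_def, sub_self]

end Local

/-! ### Global: finiteness of the support -/

section Global

variable (K : Type) [Field K] [NumberField K]

/-- **`α_v = 0` for almost all `v`** (Serre §6.5 (c) (i); Harari, Lemma 17.8 / Milne ADT I.4.8,
cochain form, trivial module `ℤ/p ⊂ ℚ/ℤ`): for a locally constant `2`-cocycle
`g : Γ_K × Γ_K → ℚ/ℤ` with `p • g = 0` on the absolute Galois group of a number field `K`, at all but
finitely many finite places `v` the restriction of `g` to `Γ_{K_v}` (along the tree's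
`absGaloisRestrict`) is `∂β` with `β` locally constant and `p • β = 0`.  (`g` is invariant under an
open normal `N ⊴ Γ_K`; `N ⊇ Gal(K̄/E)` for a finite Galois `E`; the inertia groups at almost all `v`
fix `E` (`eventually_forall_inertia_mem_fixingSubgroup`), so `res⁻¹(N) ⊇ I_{K_v}` and
`twoCocycle_nsmul_split_levelOne_of_invariant` applies.)
[cite: SerreDurham1977, §6.5 (c) (i)] [cite: NeukirchANT1999, Ch. III §2 Thm. (2.6)] -/
theorem twoCocycle_nsmul_split_levelOne_eventually {p : ℕ} (hp : 0 < p)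
    (g : absoluteGaloisGroup K → absoluteGaloisGroup K → AddCircle (1 : ℚ))
    (hg : IsLocallyConstant (Function.uncurry g))
    (hcoc : ∀ σ τ υ, g σ τ + g (σ * τ) υ = g τ υ + g σ (τ * υ)) (hpg : ∀ σ τ, p • g σ τ = 0) :
    ∀ᶠ v : HeightOneSpectrum (𝓞 K) in Filter.cofinite,
      ∃ β : absoluteGaloisGroup (v.adicCompletion K) → AddCircle (1 : ℚ), IsLocallyConstant β ∧
        (∀ σ τ, g (absGaloisRestrict K (v.adicCompletion K) σ)
            (absGaloisRestrict K (v.adicCompletion K) τ) + β (σ * τ) = β σ + β τ) ∧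
        ∀ σ, p • β σ = 0 := by
  classical
  haveI : CompactSpace (absoluteGaloisGroup K) := absoluteGaloisGroup_compactSpace K
  -- uniform local constancy: an open normal subgroup `N`
  obtain ⟨N, hN⟩ := exists_openNormalSubgroup_forall_mul_eq_of_isLocallyConstant₂ hg
  -- a finite Galois `E` with `Gal(K̄/E) ≤ N`
  obtain ⟨E, hEfin, hEgal, hE⟩ := exists_isGalois_mem_of_restrict_eq_one K N.isOpen N.one_mem
  haveI := hEfin
  haveI := hEgal
  -- inertia at almost all `v` fixes `E`
  filter_upwards [eventually_forall_inertia_mem_fixingSubgroup (F := K) E] with v hv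
  set r := absGaloisRestrict K (v.adicCompletion K) with hr_def
  -- `res (I_{K_v}) ≤ N`
  have hIN : ∀ ι ∈ absInertia (v.adicCompletion K), r ι ∈ N := by
    intro ι hι
    have h1 : r ι ∈ (adicCompletionPrime K v).inertia (absoluteGaloisGroup K) := by
      rw [inertia_adicCompletionPrime_eq_map_absInertia K v]
      exact Subgroup.mem_map_of_mem _ hι
    have h2 := hv _ (adicCompletionPrime_mem_primesAbove K v) _ h1
    apply hE
    have h3 : r ι ∈ (absRestrictNormalHom (K := K) E).ker := by
      change absoluteGaloisGroup.toAlgEquiv K (r ι) ∈ (AlgEquiv.restrictNormalHom E).ker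
      rw [IntermediateField.restrictNormalHom_ker]
      exact h2
    exact h3
  -- the open normal subgroup `res⁻¹(N) ⊇ I_{K_v}` of `Γ_{K_v}`
  set U : Subgroup (absoluteGaloisGroup (v.adicCompletion K)) := N.toSubgroup.comap r.toMonoidHom
    with hU_def
  haveI : U.Normal := Subgroup.Normal.comap inferInstance _
  have hUopen : IsOpen (U : Set (absoluteGaloisGroup (v.adicCompletion K))) :=
    N.isOpen.preimage r.continuous
  have hIU : absInertia (v.adicCompletion K) ≤ U := fun ι hι => hIN ι hι
  refine twoCocycle_nsmul_split_levelOne_of_invariant (v.adicCompletion K) hp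
    (fun σ τ => g (r σ) (r τ)) (fun σ τ υ => by simpa only [map_mul] using hcoc (r σ) (r τ) (r υ))
    (fun σ τ => hpg _ _) U hUopen hIU fun σ τ u₁ hu₁ u₂ hu₂ => ?_
  simp only [map_mul]
  exact hN _ _ _ hu₁ _ hu₂

end Global

end Literature.NumberTheory.GaloisRepresentations

end
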